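import Summits.QuantumFields.YangMills.Theorems.UnitScaleTiltProp7QkLocalGaugeComparisonBlockSet
import Summits.QuantumFields.YangMills.Theorems.UnitScaleTiltProp7NestedMeanTowerCloseness
import Literature.MathematicalPhysics.QuantumFieldTheory.Balaban1983to89.B13BondAveragingReadingNumerals
import HarnessLib

/-!
# Route `UnitScaleTilt`, crux K1 «MinimiserStabilityRegPr» (stmt-QuantumFields-19200), EX row `hGF[Lift]` (curved member) — **LOD LINE, PEN (L5″) (M-III′) BINDER `hw`:
# BLOCK FLATNESS ⟹ COMB-WALK FLATNESS** — discharges the walk-membership hypothesis `hw` of ✓`Prop7TopMeanFrameRows.frameRow_of_walkFlat` (px5 p754796) and of its consumers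
(✓p755451, ✓p757348): if `‖W♭(b) − 1‖ ≤ δ′` on every fine bond `b` with both ends in a block `Y` meeting `supp χ̃`, then every bond of the two corner combs of that block (to `x ∈ B(Y)`
and to the base point `embIter (K−n) Y`) is `δ′`-flat — the comb `walk (corner Y) (treeWord (rel (corner Y) t))` of `t ∈ B(Y)` STAYS IN `B(Y)` (routeR-w4 g26's
✓`Prop7QkLocalGaugeComparisonBlockSet.iterBlockOf_of_mem_walk_treeWord`, with `rel (corner Y) t = (t mod L^{K−n})` by ROW-T's ✓`rel_corner_apply`).

Cell `ym3-torus` (HUMAN RULING D-0037, YM ladder rung R3 — NOT d = 4, NOT infinite volume, NOT a mass gap, NOT Clay).  Width seat `ym3-torus-px5` gen 11.  THEOREMS ONLY (0 `def`,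
0 `sorry`); `--supports stmt-QuantumFields-19200 --as helper`, count-neutral.  HONEST LABEL (★★OWNER RULING №33 (6)): curved γ-row supplier line (LOD localisation), pen (L5″); lattice
bookkeeping only; nothing of (3.49), Thm 3.1∕3.3, `h349`, `hGF`, EX ∕ 19200 is proved here.

References: T. Bałaban, CMP **95** (1984) 17–40 [Balaban1984PropagatorsI] ((1.6)–(1.7) p.18, (1.18) p.20); CMP **98** (1985) 17–51 [Balaban1985Averaging] ((14) p.19, p.24).
-/

set_option autoImplicit false

noncomputable section

open scoped Matrix.Norms.L2Operator

namespace Summit.QuantumFields.YangMills.Theorems.Prop7TopMeanFrameWalkFlat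

open Literature.MathematicalPhysics.QuantumFieldTheory.Balaban1983to89
open T4Continuum BlockAveraging
open B7Prop1Explicit (treeWord)
open B5Eq118OneStroke (iterBlockOf iterBlock mem_iterBlock)
open B15DeterminingSets (embIter)
open B10Eq27TorusAxialLog (rel)
open Literature.MathematicalPhysics.QuantumFieldTheory.Balaban1983to89.T3ContinuumYM3Torus
open T3SectALandauChart (bgUnits)
open Summit.QuantumFields.YangMills.Theorems.Prop7NestedMeanTowerCloseness (rel_corner_apply)
open Summit.QuantumFields.YangMills.Theorems.Prop7QkLocalGaugeComparisonBlockSet (iterBlockOf_of_mem_walk_treeWord)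
open B13BondAveragingReadingNumerals (embIter_mem_iterBlock')

variable (F : T3Family) {n K : ℕ}

/-- ★★ **THE CORNER COMB OF A BLOCK SITE STAYS IN THE BLOCK**: for `x`, `t` in the same `(K−n)`-block, every step of `walk (corner B(x)) (treeWord (rel (corner B(x)) t))` has source and
target in that block. [cite: Balaban1984PropagatorsI, (1.6)-(1.7) p.18; Balaban1985Averaging, (14) p.19, p.24] -/
theorem iterBlockOf_of_mem_comb (x t : Site (F.P K) 0) (ht : iterBlockOf (K - n) t = iterBlockOf (K - n) x) {st : LStep (F.P K) 0}
    (hst : st ∈ walk (Site.fibreSite 0 (K - n) (iterBlockOf (K - n) x) fun _ => (⟨0, pow_pos (F.P K).L_pos (K - n)⟩ : Fin ((F.P K).L ^ (K - n)))) (treeWord (rel (Site.fibreSite 0 (K - n) (iterBlockOf (K - n) x) fun _ => (⟨0, pow_pos (F.P K).L_pos (K - n)⟩ : Fin ((F.P K).L ^ (K - n)))) t))) :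
    iterBlockOf (K - n) st.bond.src = iterBlockOf (K - n) x ∧ iterBlockOf (K - n) st.bond.tgt = iterBlockOf (K - n) x := by
  have hk : K - n ≤ (F.P K).m + (F.P K).K := by show K - n ≤ F.m + K; have := F.hm; omega
  have h0 : 0 < (F.P K).L ^ (K - n) := pow_pos (F.P K).L_pos (K - n)
  set r : Fin (F.P K).d → Fin ((F.P K).L ^ (K - n)) := fun ν => ⟨(t ν).val % (F.P K).L ^ (K - n), Nat.mod_lt _ h0⟩ with hr
  have hrel : rel (Site.fibreSite 0 (K - n) (iterBlockOf (K - n) x) fun _ => (⟨0, pow_pos (F.P K).L_pos (K - n)⟩ : Fin ((F.P K).L ^ (K - n)))) t = fun ν => ((r ν : ℕ) : ℤ) := by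
    funext ν
    rw [rel_corner_apply hk ht h0 ν]
  rw [hrel] at hst
  exact iterBlockOf_of_mem_walk_treeWord hk (iterBlockOf (K - n) x) r hst

/-- ★★★ **THE BINDER `hw` OF ✓`frameRow_of_walkFlat`∕✓p755451∕✓p757348 FROM BLOCK FLATNESS**: if on every block `Y` meeting `supp χ̃` every fine bond with both ends in `B(Y)` satisfies
`‖W♭(b) − 1‖ ≤ δ′`, then on every such `Y` and every `x ∈ B(Y)` both corner combs (to `embIter (K−n) Y` and to `x`) are `δ′`-flat.
[cite: Balaban1984PropagatorsI, (1.6)-(1.7) p.18, (1.18) p.20; Balaban1985Averaging, (14) p.19, p.24] -/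
theorem walkFlat_of_blockFlat (W : GaugeField (F.P K) 0 (Matrix.specialUnitaryGroup (Fin 2) ℂ)) (χt : Site (F.P K) 0 → ℝ) {δ' : ℝ}
    (hflat : ∀ Y : Site (F.P K) (K - n), (∃ x ∈ iterBlock (K - n) Y, χt x ≠ 0) → ∀ b : PBond (F.P K) 0,
      iterBlockOf (K - n) b.src = Y → iterBlockOf (K - n) b.tgt = Y → ‖((bgUnits F K W b : (Matrix (Fin 2) (Fin 2) ℂ)ˣ) : Matrix (Fin 2) (Fin 2) ℂ) - 1‖ ≤ δ') :
    ∀ Y : Site (F.P K) (K - n), (∃ x ∈ iterBlock (K - n) Y, χt x ≠ 0) → ∀ x ∈ iterBlock (K - n) Y,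
      (∀ st ∈ walk (Site.fibreSite 0 (K - n) (iterBlockOf (K - n) x) fun _ => (⟨0, pow_pos (F.P K).L_pos (K - n)⟩ : Fin ((F.P K).L ^ (K - n)))) (treeWord (rel (Site.fibreSite 0 (K - n) (iterBlockOf (K - n) x) fun _ => (⟨0, pow_pos (F.P K).L_pos (K - n)⟩ : Fin ((F.P K).L ^ (K - n)))) (embIter (K - n) Y))), ‖((bgUnits F K W st.bond : (Matrix (Fin 2) (Fin 2) ℂ)ˣ) : Matrix (Fin 2) (Fin 2) ℂ) - 1‖ ≤ δ') ∧
      (∀ st ∈ walk (Site.fibreSite 0 (K - n) (iterBlockOf (K - n) x) fun _ => (⟨0, pow_pos (F.P K).L_pos (K - n)⟩ : Fin ((F.P K).L ^ (K - n)))) (treeWord (rel (Site.fibreSite 0 (K - n) (iterBlockOf (K - n) x) fun _ => (⟨0, pow_pos (F.P K).L_pos (K - n)⟩ : Fin ((F.P K).L ^ (K - n)))) x)), ‖((bgUnits F K W st.bond : (Matrix (Fin 2) (Fin 2) ℂ)ˣ) : Matrix (Fin 2) (Fin 2) ℂ) - 1‖ ≤ δ') := by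
  intro Y hY x hx
  have hk : K - n ≤ (F.P K).m + (F.P K).K := by show K - n ≤ F.m + K; have := F.hm; omega
  have hxY : iterBlockOf (K - n) x = Y := (mem_iterBlock (K - n) Y x).mp hx
  have heY : iterBlockOf (K - n) (embIter (K - n) Y) = iterBlockOf (K - n) x := by
    rw [hxY]; exact (mem_iterBlock (K - n) Y _).mp (embIter_mem_iterBlock' hk Y)
  refine ⟨fun st hst => ?_, fun st hst => ?_⟩
  · obtain ⟨h1, h2⟩ := iterBlockOf_of_mem_comb F x (embIter (K - n) Y) heY hst
    exact hflat Y hY st.bond (h1.trans hxY) (h2.trans hxY)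
  · obtain ⟨h1, h2⟩ := iterBlockOf_of_mem_comb F x x rfl hst
    exact hflat Y hY st.bond (h1.trans hxY) (h2.trans hxY)

end Summit.QuantumFields.YangMills.Theorems.Prop7TopMeanFrameWalkFlat
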